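import Literature.AnabelianGeometry.EtaleTheta.Discharge.Sec3Cor38Cor411ii
import Literature.AnabelianGeometry.EtaleTheta.Discharge.Sec3Cor38CriterionCoordOfRlf
import Literature.AnabelianGeometry.EtaleTheta.Discharge.Sec3Remark363OfRlf
import Literature.AnabelianGeometry.EtaleTheta.Discharge.Sec3RatFnMonoidOn
import Literature.AnabelianGeometry.EtaleTheta.Discharge.Sec3BLambdaInjectiveOfRlf
import Literature.AnabelianGeometry.EtaleTheta.Discharge.Sec3ConstantLineToyGenuine
import Literature.AnabelianGeometry.EtaleTheta.Discharge.Sec3HQToyGenuine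
import Literature.AlgebraicGeometry.Frobenioids.EquivalencePreStepsFSMFF2008Assembly

/-!
# [EtTh] Corollary 3.8 (ii) AS TYPED holds OUTRIGHT at the tree's genuine-vocabulary tempered Frobenioid
# (non-vacuity of the node closer's print-level hypothesis list over constructed `Λ = ℤ` data)

Mochizuki, *The étale theta function and its Frobenioid-theoretic manifestations*, Publ. RIMS **45** (2009),
Cor. 3.8 (ii) PDF pp. 80–82 [cite: MochizukiEtTh2009, Cor 3.8 p.81]; Def. 3.3 (iii) p.73, Prop. 3.4 (ii) p.74,
Def. 3.6 (i)/(ii) pp. 76–77, Rmk. 3.3.1 p.73, Rmk. 3.6.3 p.79.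
abc-iut cell, layer L2, cone node `EtTh:Cor3.8(ii)` (kernel id `N_EtTh_Cor3_8_ii`), seat abc-iut-w6-d040 (gen 2);
PROOF-ONLY (0 definitions) instantiation witness, companion of this lineage's
`Discharge/Sec3Cor38iiOfRatSupport.lean` (p437110).  There the node closer over the CONSTRUCTED Def. 3.6 (i) data
of monoid type `ℤ`, `Cor38Hyp.cor38_ii_ofRlfZ_of_structural`, has the hypothesis list (per side)

  `hB₀inj` (pull-backs of `B₀` injective) · `hFSM` (FSM-morphisms of `D` are isomorphisms) · `dm.Prop34` (the typed
  Prop. 3.4 structure) · `hF₀inv` (`F₀(Y)` inverse-closed) · `hcyc` (Def. 3.6 (ii)(b): divisors of constants are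
  powers of one effective divisor) · `hZQ` (Rmk. 3.3.1) · `hsat` (rational support of `Φ(W)` in `Φ₀(Y_W)^rlf`),

besides `h : Cor38Hyp C₁ C₂`.  THIS FILE checks every one of them at abc-iut-w5-d164's
`Toy.genuineTemperedFrobenioid R S` (`TemperedFrobenioidToyGenuine.lean`, p427934: the tempered Frobenioid over
`ofRlfZ Toy.divisorMonoids _` with the GENUINE realification `ℕ^rlf`, the genuine [FrdI] vocabularies
`treeMonoidVocab` / `treeCatVocab` and a Frobenioid certificate) and runs the SAME composition
(abc-iut-L2-t3's `isMonoidOn_ratFnFunctor` ∘ `RealifiedDivisorMonoids.ofRlfZ_hBinj`, abc-iut-w4-d008's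
`remark363_ofRlfZ`, abc-iut-w5-d130's `bsFldPreStepLimitCriterion_ofRlfZ_of_ratSupport`, this lineage's
`Cor38Hyp.cor38_ii_canonical_of_thm34ii` with `FrdI.Thm34ii_holds`) END-TO-END:

* `Toy.hB₀inj_divisorMonoids`, `Toy.hFSM_discretePUnit`, `Toy.hF₀inv_divisorMonoids` — the three clauses not yet
  in the tree at this datum (`B₀ = ℤ` constant functor; every morphism of `Discrete PUnit` is an isomorphism;
  `F₀ = B₀ = ℤ` is a group); `Prop34` = abc-iut-w4-d008's `Toy.prop34_divisorMonoids`, `hcyc` =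
  `Toy.cnstCyclic_divisorMonoids`, `hZQ` = abc-iut-w5-d130's `Toy.isZQMonoprime_primes_Φ₀`, `hsat` =
  `Toy.ratSupport_genuine`;
* **`Toy.cor38_ii_genuine (h : Cor38Hyp C C) : Cor38_ii (Def. 4.5 (iv)) h`** for `C := Toy.genuineTemperedFrobenioid
  R S` — [EtTh] Cor. 3.8 (ii) AS TYPED (abc-iut-L2-t3's `Cor38_ii`, vocabulary parameter := [FrdI] Def. 4.5 (iv))
  with NO binder beyond the Cor. 3.8 standing-hypotheses structure `h`, for EVERY such `h` (any self-equivalence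
  `Ψ`);
* `Toy.exists_cor38_ii_genuine : ∃ h : Cor38Hyp C C, Cor38_ii (Def. 4.5 (iv)) h` — with abc-iut-w5-d164's
  inhabitant `Toy.nonempty_cor38Hyp_genuine` (`Ψ := 𝟭`): the node's typed statement has an UNCONDITIONAL kernel
  instance (NV census: conclusion `Cor38_ii` no longer kernel-zero).

* (v2 append) `Toy.isDivSlim45iv_discretePUnit` — the closers' vocabulary parameter ([FrdI] Def. 4.5 (iv) "Div-slim"
  read on `(E, Φ)`) HOLDS at the one-object base; hence **`Toy.cor38_ii_conclusion_genuine (h)`: the CONCLUSION of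
  Cor. 3.8 (ii) itself** — `Ψ` preserves the base-field-theoretic morphisms and induces a compatible self-equivalence
  `Ψbs` of the hull `C^{bs-fld}` — unconditionally at the genuine toy, for every `h`.

HONEST LABEL: a consistency / instantiation witness at DEGENERATE geometry (one object, one prime, `Λ = ℤ`, all
functions constant); it shows that the print-level hypothesis list of the node closer is jointly satisfiable
together with `Cor38Hyp` over constructed `ofRlfZ` data and that the composition fires, nothing more.  NOT the
tempered Frobenioid of a curve; refereed pre-IUT material; nothing here bears on [IUTchIII] Cor. 3.12; no side
taken; typed ≠ proved.
-/

noncomputable section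

namespace Literature.AnabelianGeometry.EtaleTheta

open CategoryTheory Opposite Function Literature.AlgebraicGeometry.Frobenioids

namespace Toy

open Example39NV

/-- (hB₀inj) for the toy Def. 3.3 (iii) data `Toy.divisorMonoids`: `B₀ = ℤ` is a constant functor on the
one-object base, so every pull-back of `B₀` is the identity, injective. [cite: MochizukiEtTh2009, Def 3.3 p.73] -/
theorem hB₀inj_divisorMonoids {Y Y' : (Discrete PUnit.{1})ᵒᵖ} (g : Y ⟶ Y') :
    Injective (divisorMonoids.B₀.map g).hom := by
  change Injective (𝟙 (CommMonCat.of (Multiplicative ℤ)) : CommMonCat.of (Multiplicative ℤ) ⟶ _).hom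
  rw [CommMonCat.hom_id]
  exact injective_id

/-- (hFSM) for the one-object base `Discrete PUnit`: every morphism is an isomorphism (a fortiori every
FSM-morphism). [cite: MochizukiFrdI2008, §0 p.18] -/
theorem hFSM_discretePUnit {A B : Discrete PUnit.{1}} (α : B ⟶ A) (_hα : IsFSM α) : IsIso α :=
  inferInstance

/-- (hF₀inv) for the toy Def. 3.3 (iii) data: `F₀(Y) = B₀(Y) = ℤ` is a group, hence inverse-closed
("`F₀(Y) ≅ L^×`", Prop. 3.4 (ii)). [cite: MochizukiEtTh2009, Prop 3.4 (ii) p.74] -/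
theorem hF₀inv_divisorMonoids (Y : (Discrete PUnit.{1})ᵒᵖ) (b : divisorMonoids.B₀.obj Y)
    (_hb : b ∈ divisorMonoids.F₀ Y) : ∃ b' ∈ divisorMonoids.F₀ Y, b' * b = 1 := by
  let c : Multiplicative ℤ := b
  refine ⟨(c⁻¹ : Multiplicative ℤ), trivial, ?_⟩
  exact inv_mul_cancel c

variable (R S : ((Discrete PUnit.{1})ᵒᵖ ⥤ CommMonCat.{0}) → Prop)

/-- The standing residual `hBmon` ("`𝔹` is a monoid on `D`") at the genuine toy, through abc-iut-L2-t3's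
STRUCTURAL route `isMonoidOn_ratFnFunctor` (`hBinj` ⟸ `hB₀inj` by `RealifiedDivisorMonoids.ofRlfZ_hBinj`, `hFSM`).
[cite: MochizukiEtTh2009, Def 3.6 p.77] -/
theorem isMonoidOn_ratFnFunctor_genuine_of_structural :
    IsMonoidOn (genuineTemperedFrobenioid R S).ratFnFunctor :=
  (genuineTemperedFrobenioid R S).isMonoidOn_ratFnFunctor
    (RealifiedDivisorMonoids.ofRlfZ_hBinj divisorMonoids isPerfFactorial_Φ₀ fun g => hB₀inj_divisorMonoids g)
    fun α hα => hFSM_discretePUnit α hα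

/-- [EtTh] Rmk. 3.6.3 at the genuine toy by abc-iut-w4-d008's `remark363_ofRlfZ` (`Prop34 ✓`, `hF₀inv ✓`).
[cite: MochizukiEtTh2009, Rmk 3.6.3 p.79] -/
theorem remark363_genuine_ofRlfZ : (genuineTemperedFrobenioid R S).Remark363 :=
  (genuineTemperedFrobenioid R S).remark363_ofRlfZ prop34_divisorMonoids hF₀inv_divisorMonoids

/-- Row C38-L05 at the genuine toy by abc-iut-w5-d130's `bsFldPreStepLimitCriterion_ofRlfZ_of_ratSupport`
(`Prop34 ✓`, `hcyc ✓`, `hZQ ✓`, `hsat ✓`), for THE perfection attached to the structural Frobenioid certificate.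
[cite: MochizukiEtTh2009, Cor 3.8 p.81] -/
theorem bsFldPreStepLimitCriterion_genuine_of_ratSupport :
    (genuineTemperedFrobenioid R S).BsFldPreStepLimitCriterion
      (PreFrobenioidData.perfection ((genuineTemperedFrobenioid R S).isFrobenioid_treeCatVocab_of_isMonoidOn
        (isMonoidOn_ratFnFunctor_genuine_of_structural R S))) :=
  (genuineTemperedFrobenioid R S).bsFldPreStepLimitCriterion_ofRlfZ_of_ratSupport _ prop34_divisorMonoids
    cnstCyclic_divisorMonoids (fun _ 𝔭 => isZQMonoprime_primes_Φ₀ _ 𝔭) (fun _ => ratSupport_genuine R S _)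

/-- **[EtTh] Cor. 3.8 (ii) AS TYPED holds OUTRIGHT at the genuine toy, for every inhabitant `h` of the Cor. 3.8
standing hypotheses** (`C₁ = C₂ := Toy.genuineTemperedFrobenioid R S`, any equivalence `Ψ : C ≌ C`): abc-iut-L2-t3's
`Cor38_ii` with vocabulary parameter := [FrdI] Def. 4.5 (iv), by this lineage's node closer
`Cor38Hyp.cor38_ii_canonical_of_thm34ii` (p432040) with `FrdI.Thm34ii_holds` and the three inputs above — i.e. the
hypothesis list of `Cor38Hyp.cor38_ii_ofRlfZ_of_structural` (p437110) CHECKED at this datum and the composition run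
end-to-end. [cite: MochizukiEtTh2009, Cor 3.8 p.81] -/
theorem cor38_ii_genuine (h : Cor38Hyp (genuineTemperedFrobenioid R S) (genuineTemperedFrobenioid R S)) :
    Literature.AnabelianGeometry.EtaleTheta.Cor38_ii
      (fun E _ Φ => ∀ (A : E) (α : Aut (Over.forget A)),
        (∀ (B : Over A) (x : Φ.obj (op B.left)),
          Literature.AlgebraicGeometry.Frobenioids.pull Φ (α.hom.app B) x = x) → α = 1) h :=
  h.cor38_ii_canonical_of_thm34ii FrdI.Thm34ii_holds (isMonoidOn_ratFnFunctor_genuine_of_structural R S)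
    (isMonoidOn_ratFnFunctor_genuine_of_structural R S) (remark363_genuine_ofRlfZ R S)
    (remark363_genuine_ofRlfZ R S) (bsFldPreStepLimitCriterion_genuine_of_ratSupport R S)
    (bsFldPreStepLimitCriterion_genuine_of_ratSupport R S)

/-- **The typed statement of the node `EtTh:Cor3.8(ii)` has an unconditional kernel instance**: with
abc-iut-w5-d164's inhabitant of `Cor38Hyp` at the genuine toy (`Ψ := 𝟭`, `Toy.nonempty_cor38Hyp_genuine`).
[cite: MochizukiEtTh2009, Cor 3.8 p.81] -/
theorem exists_cor38_ii_genuine :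
    ∃ h : Cor38Hyp (genuineTemperedFrobenioid R S) (genuineTemperedFrobenioid R S),
      Literature.AnabelianGeometry.EtaleTheta.Cor38_ii
        (fun E _ Φ => ∀ (A : E) (α : Aut (Over.forget A)),
          (∀ (B : Over A) (x : Φ.obj (op B.left)),
            Literature.AlgebraicGeometry.Frobenioids.pull Φ (α.hom.app B) x = x) → α = 1) h := by
  obtain ⟨h⟩ := nonempty_cor38Hyp_genuine R S
  exact ⟨h, cor38_ii_genuine R S h⟩

/-! ### v2 (append): the vocabulary parameter holds at the toy base, so the CONCLUSION of Cor. 3.8 (ii) holds outright -/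

/-- [FrdI] Def. 4.5 (iv) "Div-slim" read on `(E, Φ)` — the vocabulary parameter of this lineage's node closers — HOLDS
for the one-object base `Discrete PUnit` and ANY `Φ`: every automorphism of the forgetful functor
`Over A ⥤ Discrete PUnit` is the identity (its components are endomorphisms in a discrete category).
[cite: MochizukiFrdI2008, Def. 4.5 (iv) p.88] -/
theorem isDivSlim45iv_discretePUnit (Φ : (Discrete PUnit.{1})ᵒᵖ ⥤ CommMonCat.{0}) (A : Discrete PUnit.{1})
    (α : Aut (Over.forget A))
    (_h : ∀ (B : Over A) (x : Φ.obj (op B.left)),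
      Literature.AlgebraicGeometry.Frobenioids.pull Φ (α.hom.app B) x = x) :
    α = 1 :=
  Iso.ext (NatTrans.ext (funext fun _ => Subsingleton.elim _ _))

/-- **The CONCLUSION of [EtTh] Cor. 3.8 (ii) at the genuine toy, unconditionally**: for every inhabitant `h` of the
Cor. 3.8 standing hypotheses on `C := Toy.genuineTemperedFrobenioid R S`, `Ψ` preserves the base-field-theoretic
morphisms AND induces a compatible self-equivalence `Ψbs` of the base-field-theoretic hull `C^{bs-fld}`
(`C^{bs-fld} → C → C ≅ C^{bs-fld} → C^{bs-fld} → C`) — the antecedents "`D_i` Div-slim" ([FrdI] Def. 4.5 (iv)) holding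
at the one-object base (`isDivSlim45iv_discretePUnit`). [cite: MochizukiEtTh2009, Cor 3.8 p.81] -/
theorem cor38_ii_conclusion_genuine
    (h : Cor38Hyp (genuineTemperedFrobenioid R S) (genuineTemperedFrobenioid R S)) :
    PreservesBaseFieldTheoretic h ∧
      ∃ Ψbs : (genuineTemperedFrobenioid R S).hullCategory ≌ (genuineTemperedFrobenioid R S).hullCategory,
        Nonempty ((genuineTemperedFrobenioid R S).hull ⋙ h.Ψ.functor ≅
          Ψbs.functor ⋙ (genuineTemperedFrobenioid R S).hull) :=
  cor38_ii_genuine R S h (isDivSlim45iv_discretePUnit _) (isDivSlim45iv_discretePUnit _)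

/-- … and with abc-iut-w5-d164's inhabitant (`Ψ := 𝟭`): the conclusion of Cor. 3.8 (ii) has an unconditional kernel
instance. [cite: MochizukiEtTh2009, Cor 3.8 p.81] -/
theorem exists_cor38_ii_conclusion_genuine :
    ∃ h : Cor38Hyp (genuineTemperedFrobenioid R S) (genuineTemperedFrobenioid R S),
      PreservesBaseFieldTheoretic h ∧
        ∃ Ψbs : (genuineTemperedFrobenioid R S).hullCategory ≌ (genuineTemperedFrobenioid R S).hullCategory,
          Nonempty ((genuineTemperedFrobenioid R S).hull ⋙ h.Ψ.functor ≅
            Ψbs.functor ⋙ (genuineTemperedFrobenioid R S).hull) := by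
  obtain ⟨h⟩ := nonempty_cor38Hyp_genuine R S
  exact ⟨h, cor38_ii_conclusion_genuine R S h⟩

end Toy

end Literature.AnabelianGeometry.EtaleTheta

end
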